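import Summits.BirchSwinnertonDyer.BirchSwinnertonDyer.Theorems.ClassRecordThreeCornerAtThreeMilneTamagawaLiftNode
import Summits.BirchSwinnertonDyer.BirchSwinnertonDyer.Theorems.ClassRecordThreeCornerAtThreeMilneTamagawaLiftCusp
import Summits.BirchSwinnertonDyer.BirchSwinnertonDyer.Theorems.ClassRecordThreeCornerAtThreeMilneTamagawaCoboundaryE0
import HarnessLib

/-!
# Milne *ADT* I Prop. 3.8 in the kernel, part 4: the LANG–NÉRON SURJECTIVITY at a place of bad reduction — every Frobenius-stable
# component of `E(K_v^{nr})` modulo `E₀(K_v^{nr})` carries a `K_v`-RATIONAL point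
# (cell `bsd-stepL`, seat `bsd-stepL-corner3-p2` g10 = WIDTH-LEVER lane B; toward the DISCHARGE of the cite-only Literature fact
# `Milne2006_localTamagawaNumber_smul_unramifiedClass_eq_zero` (tam3-p1 g15, p614601); `--supports stmt-BirchSwinnertonDyer-21420 --as helper`)

Model currency of x11b3-p8 (`V = M ⊗ K̄_v`, `M = W.localMinimalIntegralModel v`, Galois action by `Affine.Point.map (toAlgEquiv σ)`, «`E₀`» =
`HasNonsingularReduction` on the `𝒪_w`-model `M.map ι` through `Affine.Point.congrEquiv (baseChange_map_eq_baseChange_map hι M)`).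
* `exists_fixed_sub_mem_E0_of_bad` — at a place `v` of MULTIPLICATIVE or ADDITIVE reduction, with `F` an arithmetic Frobenius at `𝔐`: for
  every `x ∈ V(K̄_v)` fixed by the inertia group `I_𝔐` whose Frobenius translate lies in its own component (`F x − x ∈ E₀`) there is a
  point `y` FIXED BY ALL OF `Γ_{K_v}` (i.e. `K_v`-rational) with `x − y ∈ E₀`. Proof: the coboundary `∂x` is a crossed homomorphism with
  open zero set (the stabiliser of `x`, `isOpen_setOf_map_eq`) vanishing on `I_𝔐`; Step 1 LOCATED IN `E₀` at `F` (parts 1–2,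
  `exists_lift_sub_mem_kernel_of_has{Multiplicative,Additive}ReductionAt_mem_E0`, fed with `m := F x − x ∈ E₀`); Steps 2–4 with the
  location of the primitive (part 3, `exists_mem_E0_eq_map_sub_of_cocycle_of_lift`): `∂x = ∂P` with `P ∈ E₀`; `y := x − P`.
This is the surjectivity half of `E(K_v)/E₀(K_v) ≅ Φ_v(k_v) = (E(K_v^{nr})/E₀(K_v^{nr}))^{Frob}` (Lang's theorem for the identity component
of the Néron model + Hensel; Silverman *AEC* VII §6, *ATAEC* IV Cor. 9.2; the injectivity half is n1011's
`relIndex_nonsingularPart_ker_dvd_localTamagawaNumber`), the step that identifies the constant `#Φ̃^{Frob}` of the Herbrand count with the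
Tamagawa number `c_v` in part 5. Nothing beyond x11b3-p8's ingredients (credit: x11b3-p8, the tree's `PeriodIndexSupportProofs` ∕
`UnramifiedCoboundaryInputs`). HONEST FRAMING: one theorem; no definition, no named fact, no `sorry`; nothing about BSD, no stub closes,
no item is credited (T7). References: [cite: MilneADT2006, Ch. I Prop. 3.8 (proof)] [cite: SilvermanAEC2009, VII §2 Prop. 2.1, VII §6, Ex. 7.6]
[cite: SilvermanATAEC1994, IV Cor. 9.2 (E(K)/E₀(K) ≅ Ẽ(k)/Ẽ⁰(k))] [cite: LangAlgebraicGroupsFiniteFields1956, Thm. 2].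
-/

set_option linter.dupNamespace false
set_option autoImplicit false

noncomputable section

open scoped Classical NNReal Topology
open NumberField IsDedekindDomain Field

universe u

namespace Summit.BirchSwinnertonDyer.BirchSwinnertonDyer.Theorems.MilneTamagawa

open WeierstrassCurve Literature.NumberTheory.EllipticCurves
  Literature.NumberTheory.EllipticCurves.FormalGroupChart
  Literature.NumberTheory.GaloisRepresentations
  Literature.NumberTheory.GaloisRepresentations.IsNonarchimedeanLocalField IsDedekindDomain.HeightOneSpectrum
  Summit.BirchSwinnertonDyer.Rank1Residual.X11b.Three.UnramifiedNode

variable {K : Type u} [Field K] [NumberField K] (W : WeierstrassCurve K) {v : HeightOneSpectrum (𝓞 K)}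
  {w : Valuation (AlgebraicClosure (v.adicCompletion K)) ℝ≥0}
  (hw : ∀ x, (w x : ℝ) = spectralNorm (v.adicCompletion K) (AlgebraicClosure (v.adicCompletion K)) x)
  {ι : v.adicCompletionIntegers K →+* w.integer}
  (hι : ∀ a, ((ι a : w.integer) : AlgebraicClosure (v.adicCompletion K)) =
    algebraMap (v.adicCompletion K) (AlgebraicClosure (v.adicCompletion K)) (a : v.adicCompletion K))

include hw hι in
set_option maxHeartbeats 800000 in
/-- **Lang–Néron surjectivity at a place of bad reduction.** Let `W/K` be elliptic with multiplicative or additive reduction at the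
finite place `v`, `V = M ⊗ K̄_v` its minimal model, `W₀ = M.map ι` the `𝒪_w`-model, `𝔐` a prime of the local absolute integers with
inertia group `I_𝔐 ≤ Γ_{K_v}` and `F` an arithmetic Frobenius at `𝔐`. If `x ∈ V(K̄_v)` is fixed by `I_𝔐` and `F x − x` has nonsingular
reduction on `W₀` (the component of `x` is Frobenius-stable), then `x − y` has nonsingular reduction for some `y ∈ V(K̄_v)` fixed by every
`σ ∈ Γ_{K_v}` (a `K_v`-rational point in the component of `x`). Proof: the coboundary `∂x` is an unramified crossed homomorphism with open
zero set; parts 1–3 write it as `∂P` with `P ∈ E₀`; take `y = x − P`.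
[cite: MilneADT2006, Ch. I Prop. 3.8 (proof)] [cite: SilvermanATAEC1994, IV Cor. 9.2] [cite: SilvermanAEC2009, VII §2 Prop. 2.1] -/
theorem exists_fixed_sub_mem_E0_of_bad [W.IsElliptic]
    (hbad : W.HasMultiplicativeReductionAt v ∨ W.HasAdditiveReductionAt v)
    {𝔐 : Ideal v.localAbsIntegers} (h𝔐 : 𝔐 ∈ v.localPrimesAbove)
    [hV : (((W.localMinimalIntegralModel v).map (algebraMap (v.adicCompletionIntegers K) (v.adicCompletion K))).baseChange (AlgebraicClosure (v.adicCompletion K))).IsIntegral w.integer]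
    {F : absoluteGaloisGroup (v.adicCompletion K)} (hF : IsArithFrobAt (v.adicCompletionIntegers K) F 𝔐)
    (x : ((((W.localMinimalIntegralModel v).map (algebraMap (v.adicCompletionIntegers K) (v.adicCompletion K))).baseChange (AlgebraicClosure (v.adicCompletion K)))).toAffine.Point)
    (hxI : ∀ τ ∈ 𝔐.inertia (absoluteGaloisGroup (v.adicCompletion K)),
      WeierstrassCurve.Affine.Point.map (W' := (W.localMinimalIntegralModel v).map (algebraMap (v.adicCompletionIntegers K) (v.adicCompletion K))) ((absoluteGaloisGroup.toAlgEquiv (v.adicCompletion K) (τ) : AlgebraicClosure (v.adicCompletion K) ≃ₐ[v.adicCompletion K] AlgebraicClosure (v.adicCompletion K)) : AlgebraicClosure (v.adicCompletion K) →ₐ[v.adicCompletion K] AlgebraicClosure (v.adicCompletion K)) x = x)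
    (hxF : ((W.localMinimalIntegralModel v).map ι).HasNonsingularReduction
        (Affine.Point.congrEquiv (baseChange_map_eq_baseChange_map hι (W.localMinimalIntegralModel v)) (WeierstrassCurve.Affine.Point.map (W' := (W.localMinimalIntegralModel v).map (algebraMap (v.adicCompletionIntegers K) (v.adicCompletion K))) ((absoluteGaloisGroup.toAlgEquiv (v.adicCompletion K) (F) : AlgebraicClosure (v.adicCompletion K) ≃ₐ[v.adicCompletion K] AlgebraicClosure (v.adicCompletion K)) : AlgebraicClosure (v.adicCompletion K) →ₐ[v.adicCompletion K] AlgebraicClosure (v.adicCompletion K)) x - x))) :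
    ∃ y : ((((W.localMinimalIntegralModel v).map (algebraMap (v.adicCompletionIntegers K) (v.adicCompletion K))).baseChange (AlgebraicClosure (v.adicCompletion K)))).toAffine.Point,
      (∀ σ : absoluteGaloisGroup (v.adicCompletion K),
        WeierstrassCurve.Affine.Point.map (W' := (W.localMinimalIntegralModel v).map (algebraMap (v.adicCompletionIntegers K) (v.adicCompletion K))) ((absoluteGaloisGroup.toAlgEquiv (v.adicCompletion K) (σ) : AlgebraicClosure (v.adicCompletion K) ≃ₐ[v.adicCompletion K] AlgebraicClosure (v.adicCompletion K)) : AlgebraicClosure (v.adicCompletion K) →ₐ[v.adicCompletion K] AlgebraicClosure (v.adicCompletion K)) y = y) ∧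
      ((W.localMinimalIntegralModel v).map ι).HasNonsingularReduction
        (Affine.Point.congrEquiv (baseChange_map_eq_baseChange_map hι (W.localMinimalIntegralModel v)) (x - y)) := by
  -- the coboundary `g := ∂x`
  set g : absoluteGaloisGroup (v.adicCompletion K) → ((((W.localMinimalIntegralModel v).map (algebraMap (v.adicCompletionIntegers K) (v.adicCompletion K))).baseChange (AlgebraicClosure (v.adicCompletion K)))).toAffine.Point :=
    fun σ ↦ WeierstrassCurve.Affine.Point.map (W' := (W.localMinimalIntegralModel v).map (algebraMap (v.adicCompletionIntegers K) (v.adicCompletion K))) ((absoluteGaloisGroup.toAlgEquiv (v.adicCompletion K) (σ) : AlgebraicClosure (v.adicCompletion K) ≃ₐ[v.adicCompletion K] AlgebraicClosure (v.adicCompletion K)) : AlgebraicClosure (v.adicCompletion K) →ₐ[v.adicCompletion K] AlgebraicClosure (v.adicCompletion K)) x - x with hgdef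
  have hg : ∀ σ τ, g (σ * τ) = g σ + WeierstrassCurve.Affine.Point.map (W' := (W.localMinimalIntegralModel v).map (algebraMap (v.adicCompletionIntegers K) (v.adicCompletion K))) ((absoluteGaloisGroup.toAlgEquiv (v.adicCompletion K) (σ) : AlgebraicClosure (v.adicCompletion K) ≃ₐ[v.adicCompletion K] AlgebraicClosure (v.adicCompletion K)) : AlgebraicClosure (v.adicCompletion K) →ₐ[v.adicCompletion K] AlgebraicClosure (v.adicCompletion K)) (g τ) := by
    intro σ τ
    simp only [hgdef]
    rw [map_gal_mul, map_sub]
    abel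
  have hopen : IsOpen {σ | g σ = 0} := by
    have e : {σ | g σ = 0} = {σ : absoluteGaloisGroup (v.adicCompletion K) |
        WeierstrassCurve.Affine.Point.map (W' := (W.localMinimalIntegralModel v).map (algebraMap (v.adicCompletionIntegers K) (v.adicCompletion K))) ((absoluteGaloisGroup.toAlgEquiv (v.adicCompletion K) (σ) : AlgebraicClosure (v.adicCompletion K) ≃ₐ[v.adicCompletion K] AlgebraicClosure (v.adicCompletion K)) : AlgebraicClosure (v.adicCompletion K) →ₐ[v.adicCompletion K] AlgebraicClosure (v.adicCompletion K)) x = x} := by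
      ext σ
      simp only [hgdef, Set.mem_setOf_eq, sub_eq_zero]
    rw [e]
    exact isOpen_setOf_map_eq _ x
  have hI : ∀ τ ∈ 𝔐.inertia (absoluteGaloisGroup (v.adicCompletion K)), g τ = 0 := fun τ hτ ↦ by
    simp only [hgdef, hxI τ hτ, sub_self]
  have hφq : ∀ z : AlgebraicClosure (v.adicCompletion K), w z ≤ 1 →
      w (absoluteGaloisGroup.toAlgEquiv (v.adicCompletion K) F z -
        z ^ Nat.card (IsLocalRing.ResidueField (v.adicCompletionIntegers K))) < 1 :=
    fun z hz ↦ spectralValuation_frobenius_sub_pow_lt_one hw h𝔐 hF hz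
  -- Step 1 located in `E₀` at `F` (node ∕ cusp), fed with `m := g F = F x - x ∈ E₀`
  have hlift : ∃ b : ((((W.localMinimalIntegralModel v).map (algebraMap (v.adicCompletionIntegers K) (v.adicCompletion K))).baseChange (AlgebraicClosure (v.adicCompletion K)))).toAffine.Point,
      (∀ τ ∈ 𝔐.inertia (absoluteGaloisGroup (v.adicCompletion K)),
        WeierstrassCurve.Affine.Point.map (W' := (W.localMinimalIntegralModel v).map (algebraMap (v.adicCompletionIntegers K) (v.adicCompletion K))) ((absoluteGaloisGroup.toAlgEquiv (v.adicCompletion K) (τ) : AlgebraicClosure (v.adicCompletion K) ≃ₐ[v.adicCompletion K] AlgebraicClosure (v.adicCompletion K)) : AlgebraicClosure (v.adicCompletion K) →ₐ[v.adicCompletion K] AlgebraicClosure (v.adicCompletion K)) b = b) ∧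
      ((W.localMinimalIntegralModel v).map ι).HasNonsingularReduction
        (Affine.Point.congrEquiv (baseChange_map_eq_baseChange_map hι (W.localMinimalIntegralModel v)) (b)) ∧
      g F - (WeierstrassCurve.Affine.Point.map (W' := (W.localMinimalIntegralModel v).map (algebraMap (v.adicCompletionIntegers K) (v.adicCompletion K))) ((absoluteGaloisGroup.toAlgEquiv (v.adicCompletion K) (F) : AlgebraicClosure (v.adicCompletion K) ≃ₐ[v.adicCompletion K] AlgebraicClosure (v.adicCompletion K)) : AlgebraicClosure (v.adicCompletion K) →ₐ[v.adicCompletion K] AlgebraicClosure (v.adicCompletion K)) b - b)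
        ∈ kernel w (((W.localMinimalIntegralModel v).map (algebraMap (v.adicCompletionIntegers K) (v.adicCompletion K))).baseChange (AlgebraicClosure (v.adicCompletion K))) := by
    rcases hbad with hm | ha
    · exact exists_lift_sub_mem_kernel_of_hasMultiplicativeReductionAt_mem_E0 W hw hm h𝔐 hι hφq (g F) hxF
    · exact exists_lift_sub_mem_kernel_of_hasAdditiveReductionAt_mem_E0 hw hι W ha h𝔐 hφq (g F) hxF
  obtain ⟨P, hPE, hP⟩ := exists_mem_E0_eq_map_sub_of_cocycle_of_lift W hw hι h𝔐 hF g hg hopen hI hlift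
  refine ⟨x - P, fun σ ↦ ?_, by rw [sub_sub_cancel]; exact hPE⟩
  have h := hP σ
  simp only [hgdef] at h
  rw [map_sub]
  -- `σ x - x = σ P - P` gives `σ x - σ P = x - P`
  exact sub_eq_sub_iff_sub_eq_sub.mp h

end Summit.BirchSwinnertonDyer.BirchSwinnertonDyer.Theorems.MilneTamagawa

end
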